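import Literature.NumberTheory.Automorphic.ShimuraCurveRibetTakahashiOptimalModularityProofs
import Literature.NumberTheory.EllipticCurves.CuspFormLFunctionLevelConductorProofs
import Literature.NumberTheory.EllipticCurves.GlobalMinimalModelProofs
import Literature.NumberTheory.EllipticCurves.IsogenyVariableChangeProofs
import Literature.NumberTheory.EllipticCurves.IsogenyDualProofs
import Literature.NumberTheory.EllipticCurves.ModularCurveManinSemistableBridgeProofs
import HarnessLib
import HarnessLib.Audit.Tags

/-!
# EXO-es-g40 — `ExistsMinimalOptimalDatum` ⟸ modularity (es g40 turnkey for A-desc-g40; MEMO-es §61/§62)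

The existence row EXO of es E-es-188 / desc `ShimuraCyclic.ShimuraKernelCyclic` BY NAME (p2 g23
`shimuraKernelCyclic_of_facts … → EXO → …`): every modular parametrisation datum's newform is the newform of
a LATTICE-OPTIMAL `X₀(N)`-datum on a GLOBALLY MINIMAL elliptic curve.  Proved here from `exists_isNewformOf`
(modularity) alone, by the tree's optimal-curve package: a global minimal model `C • W` (class number one,
`hasGlobalMinimalModel_rat_holds`), `W ~ C • W` (`isIsogenous_smul`), level = conductor under modularity
(`IsNewformOf.level_eq_conductorNorm_of_exists_isNewformOf`), the relative strong Weil curve in its minimal model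
(`exists_optimal_modularParametrizationData_of_isNewformOf'`) and Knapp Prop. 12.9(a)
(`latticeEq_of_forall_modularDegree_le`).  Statement body = es `EsG40.ExistsMinimalOptimalDatum` VERBATIM.
BSD and Manin's conjecture are NOT proved; nothing about `c₀` is claimed.
-/

set_option autoImplicit false
set_option linter.dupNamespace false

noncomputable section

open scoped ModularForm
open CongruenceSubgroup WeierstrassCurve Literature.NumberTheory.EllipticCurves
  Literature.NumberTheory.EllipticCurves.ModularForms Literature.NumberTheory.Automorphic

namespace Summit.BirchSwinnertonDyer.BirchSwinnertonDyer.Theorems.ManinLocalTwoThree.ExistsMinimalOptimalDatum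

/-- **EXO ⟸ modularity.** For every elliptic `W/ℚ` and every `X₀(N)`-datum `D` of `W` there is a globally minimal
elliptic `W₀/ℚ` with an `X₀(N)`-datum `D₀`, `D₀.f = D.f`, whose lattice is EXACTLY `D₀.c · Λ(D₀.f)` (lattice-optimal:
the strong Weil curve of the class in its minimal model).  [cite: Knapp1993, Prop. 12.9(a)]
[cite: SilvermanAEC2009, VIII.8 Cor. 8.3] [cite: AtkinLehner1970, Thm. 4] -/
theorem existsMinimalOptimalDatum_of_modularity (hnf : exists_isNewformOf)
    (W : WeierstrassCurve ℚ) [W.IsElliptic] {N : ℕ} [NeZero N] (D : ModularParametrizationData W N) :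
    ∃ (W₀ : WeierstrassCurve ℚ) (_ : W₀.IsElliptic) (_ : W₀.IsGloballyMinimal) (D₀ : ModularParametrizationData W₀ N),
      D₀.f = D.f ∧ ∀ z ∈ D₀.L.lattice, ∃ w ∈ periodLattice D₀.f, z = D₀.c * w := by
  -- a global minimal model `W' = C • W` of `W`
  obtain ⟨C, hC⟩ := hasGlobalMinimalModel_rat_holds W
  haveI : (C • W).IsGloballyMinimal := hC
  -- `D.f` is the newform of `W'` too (isogeny-invariance of `L(W, s)`)
  have hf' : IsNewformOf (C • W) D.f :=
    D.isNewformOf.of_isIsogenous (WeierstrassCurve.isIsogenous_smul W C).symm_of_charZero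
  -- level = conductor (modularity in place of Carayol)
  have hN : (C • W).conductorNorm ℤ = N :=
    (IsNewformOf.level_eq_conductorNorm_of_exists_isNewformOf hnf hf').symm
  -- the strong Weil curve of the class relative to `D.f`, in its minimal model, with minimal modular degree
  obtain ⟨W₀, hE₀, hM₀, D₀, hf₀, -, hmin⟩ :=
    exists_optimal_modularParametrizationData_of_isNewformOf' N (C • W) hN hf'
  haveI := hE₀
  exact ⟨W₀, hE₀, hM₀, D₀, hf₀, D₀.latticeEq_of_forall_modularDegree_le (by simpa [hf₀] using hmin)⟩

/-- The same in the shape of the es row `EsG40.ExistsMinimalOptimalDatum` (a `∀`-statement), from modularity. -/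
theorem existsMinimalOptimalDatum_forall_of_modularity (hnf : exists_isNewformOf) :
    ∀ (W : WeierstrassCurve ℚ) [W.IsElliptic] {N : ℕ} [NeZero N] (D : ModularParametrizationData W N),
      ∃ (W₀ : WeierstrassCurve ℚ) (_ : W₀.IsElliptic) (_ : W₀.IsGloballyMinimal) (D₀ : ModularParametrizationData W₀ N),
        D₀.f = D.f ∧ ∀ z ∈ D₀.L.lattice, ∃ w ∈ periodLattice D₀.f, z = D₀.c * w :=
  fun W _ _ _ D ↦ existsMinimalOptimalDatum_of_modularity hnf W D

end Summit.BirchSwinnertonDyer.BirchSwinnertonDyer.Theorems.ManinLocalTwoThree.ExistsMinimalOptimalDatum
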